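import Mathlib.Algebra.Module.Torsion.Basic
import Mathlib.RingTheory.QuotSMulTop
import Mathlib.RingTheory.Ideal.Quotient.Operations
import Literature.NumberTheory.ComplexMultiplication.EllipticUnits.ImaginaryQuadraticMainConjectureAllPrimes
import HarnessLib

/-!
# Route `SignedLowerHalves`, crux L `SmallImageLowerHalfBothSigns` (item stmt-BirchSwinnertonDyer-23599), line `rtt_w3` v13 — E2, row D2 (the D2 DEFINER,
# BRIEF-E2 rev 3 §3, LEAD g9 GO 14:01:41Z): the RING-GENERIC θ-SPECIALISATION RECIPES of a two-variable Iwasawa datum along a surjection `φ : R ↠ L`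
# with principal kernel `(f)` — the specialised carriers `H ⧸ fH`, `M[f]`, the specialised zeta span, and their `L`-module structures THROUGH `φ`

Width seat `bsd-line-slh-p3-w3` g19 under LEAD `cruxlead-stmt-BirchSwinnertonDyer-23599` g9 (cell `bsd-ssimc`). DEFINITIONS with bodies + their defining
lemmas (review lane, `--supports stmt-BirchSwinnertonDyer-23599`); NOTHING is asserted; no instance is registered globally (the module structures are
`def`s to be installed with `letI`, as the LEAD's architecture ruling requires explicit structures); BSD is not proved by any of this.

WHAT (BRIEF-E2 rev 3 §3 (D2-a)). For commutative rings `R`, `L`, a SURJECTIVE `φ : R →+* L` with `RingHom.ker φ = Ideal.span {f}` (intended: `R = Λ_{𝒪,2} =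
IwasawaAlgebraO₂ S = 𝒪⟦T₂⟧⟦T₁⟧`, `L = Λ_𝒪 = IwasawaAlgebraO S`, `φ = φ_u` the twist specialisation of `…RttCharRoadE2TwistSpecialisation`, `f = (1+T₂) − u`):
* `moduleThrough φ hφ f hker M hM : Module L M` — for an `R`-module `M` KILLED by `f`, the `L`-module structure THROUGH `φ`: `(φ r) • m = r • m`
  (`moduleThrough_smul`), i.e. the `R ⧸ (f)`-structure (`Module.IsTorsionBySet.module`) transported along `R ⧸ ker φ ≃ L` (`RingHom.quotientKerEquivOfSurjective`);
* the specialised carriers of a `ZetaSkeleton R A H0 H1 H2` (`…EllipticUnits.ImaginaryQuadraticMainConjectureAllPrimes`, JLK 2011 §5): `Hsp := H1 ⧸ f•H1`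
  (`QuotSMulTop f H1`), `Ysp := QuotSMulTop f H2`, the defects `H2[f] = Submodule.torsionBy R H2 f`, `(H1 ⧸ Z)[f]`, all killed by `f`, with their `L`-structures
  `moduleQuotSMulTop`, `moduleTorsionBy` (instances of `moduleThrough`); the specialised zeta family `zetaSp D a := mk (D.aZeta a) ∈ Hsp` and its span
  `ZSp D = (D.Z).map mk` (`ZSp_eq_map`);
* for an `L`-algebra structure `[Algebra Λ L]` (the glue's `Λ = ℤ_p⟦T⟧`, `algebraMap = iwasawaToIwasawaO S`) the restricted `Λ`-structure is Mathlib's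
  `Module.compHom _ (algebraMap Λ L)` with `IsScalarTower.of_compHom` (no wrapper needed).
The (K)-side theorems on these carriers (`Thm52Shape ⟹ char(Hsp ⧸ ZSp)·char(H2[f]) = char(Ysp)·char((H1⧸Z)[f])`, and the glue's binders under the defect
hypotheses) are Theorems files (`…RttD2LambdaSpecialisationO`, `…RttD2DescentAlgebra`, `…RttE2KLambdaSocketGlue` and sequels).

References: [JohnsonLeungKings2011] §4.2 Def. 4.2, Lemma 4.4, §5.2, Cor. 5.3; [FukayaKato2006] Prop. 1.6.5 (3); [BourbakiAC5to7] VII §4.5.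
-/

set_option autoImplicit false
-- the Theorems namespace of this sub repeats the summit name by design (D-0017 nested layout)
set_option linter.dupNamespace false

noncomputable section

open scoped Pointwise

namespace Summit.BirchSwinnertonDyer.BirchSwinnertonDyer.Theorems.SmallImageRttD2Spec

universe u w v

section Through

variable {R : Type u} [CommRing R] {L : Type w} [CommRing L] (φ : R →+* L) (hφ : Function.Surjective φ) (f : R)
  (hker : RingHom.ker φ = Ideal.span {f})

/-- **The `L`-module structure THROUGH `φ`** on an `R`-module `M` killed by `f` (`φ : R ↠ L`, `ker φ = (f)`): `λ • m := r • m` for any `r` with `φ r = λ`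
(well defined because `(f) = ker φ` kills `M`); formally the `R ⧸ (f)`-structure transported along `L ≃ R ⧸ ker φ = R ⧸ (f)`. A `def` (install with `letI`).
[cite: JohnsonLeungKings2011, §4.2 Def. 4.2 and Lemma 4.4] -/
@[reducible]
def moduleThrough (M : Type v) [AddCommGroup M] [Module R M] (hM : ∀ m : M, f • m = 0) : Module L M :=
  letI : Module (R ⧸ Ideal.span {f}) M :=
    ((Module.isTorsionBySet_span_singleton_iff f).mpr (fun m ↦ hM m)).module
  Module.compHom M
    ((Ideal.quotEquivOfEq hker).toRingHom.comp (RingHom.quotientKerEquivOfSurjective hφ).symm.toRingHom)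

/-- **The defining property of `moduleThrough`: `(φ r) • m = r • m`.** [cite: JohnsonLeungKings2011, §4.2 Def. 4.2] -/
theorem moduleThrough_smul (M : Type v) [AddCommGroup M] [Module R M] (hM : ∀ m : M, f • m = 0) (r : R) (m : M) :
    @HSMul.hSMul L M M (@instHSMul L M (moduleThrough φ hφ f hker M hM).toSMul) (φ r) m = r • m := by
  letI : Module (R ⧸ Ideal.span {f}) M :=
    ((Module.isTorsionBySet_span_singleton_iff f).mpr (fun m ↦ hM m)).module
  change ((Ideal.quotEquivOfEq hker).toRingHom.comp (RingHom.quotientKerEquivOfSurjective hφ).symm.toRingHom) (φ r) • m = r • m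
  have h1 : (RingHom.quotientKerEquivOfSurjective hφ).symm (φ r) = Ideal.Quotient.mk (RingHom.ker φ) r := by
    rw [RingEquiv.symm_apply_eq, RingHom.quotientKerEquivOfSurjective_apply_mk]
  rw [RingHom.comp_apply, RingEquiv.toRingHom_eq_coe, RingEquiv.toRingHom_eq_coe, RingHom.coe_coe, RingHom.coe_coe, h1,
    Ideal.quotEquivOfEq_mk]
  exact Module.IsTorsionBySet.mk_smul ((Module.isTorsionBySet_span_singleton_iff f).mpr (fun m ↦ hM m)) r m

/-- `f` kills `M ⧸ fM`. [folklore] -/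
theorem smul_quotSMulTop_eq_zero (M : Type v) [AddCommGroup M] [Module R M] (q : QuotSMulTop f M) : f • q = 0 :=
  Module.mem_annihilator.mp (QuotSMulTop.mem_annihilator (M := M) f) q

/-- `f` kills `M[f]`. [folklore] -/
theorem smul_torsionBy_eq_zero (M : Type v) [AddCommGroup M] [Module R M] (x : Submodule.torsionBy R M f) : f • x = 0 :=
  Subtype.ext ((Submodule.mem_torsionBy_iff f (x : M)).mp x.2)

/-- **`Hsp = H ⧸ fH` as an `L`-module through `φ`** (the specialised carrier: for `H = H¹₂`, `Hsp` = the `θ`-line module `(H¹₂)_θ`). A `def` (install with `letI`).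
[cite: JohnsonLeungKings2011, §4.2 Lemma 4.4] -/
@[reducible]
def moduleQuotSMulTop (M : Type v) [AddCommGroup M] [Module R M] : Module L (QuotSMulTop f M) :=
  moduleThrough φ hφ f hker (QuotSMulTop f M) (smul_quotSMulTop_eq_zero f M)

/-- **`M[f]` as an `L`-module through `φ`** (the specialisation defects `H²₂[f]`, `(H¹₂ ⧸ Z)[f]`). A `def` (install with `letI`).
[cite: JohnsonLeungKings2011, §4.2 Lemma 4.4] [cite: FukayaKato2006, Prop. 1.6.5 (3)] -/
@[reducible]
def moduleTorsionBy (M : Type v) [AddCommGroup M] [Module R M] : Module L (Submodule.torsionBy R M f) :=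
  moduleThrough φ hφ f hker (Submodule.torsionBy R M f) (smul_torsionBy_eq_zero f M)

/-- `(φ r) • q = r • q` on `M ⧸ fM`. [cite: JohnsonLeungKings2011, §4.2 Def. 4.2] -/
theorem moduleQuotSMulTop_smul (M : Type v) [AddCommGroup M] [Module R M] (r : R) (q : QuotSMulTop f M) :
    @HSMul.hSMul L _ _ (@instHSMul L _ (moduleQuotSMulTop φ hφ f hker M).toSMul) (φ r) q = r • q :=
  moduleThrough_smul φ hφ f hker _ (smul_quotSMulTop_eq_zero f M) r q

/-- `(φ r) • x = r • x` on `M[f]`. [cite: JohnsonLeungKings2011, §4.2 Def. 4.2] -/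
theorem moduleTorsionBy_smul (M : Type v) [AddCommGroup M] [Module R M] (r : R) (x : Submodule.torsionBy R M f) :
    @HSMul.hSMul L _ _ (@instHSMul L _ (moduleTorsionBy φ hφ f hker M).toSMul) (φ r) x = r • x :=
  moduleThrough_smul φ hφ f hker _ (smul_torsionBy_eq_zero f M) r x

end Through


section Skeleton

open Literature.NumberTheory.ComplexMultiplication.EllipticUnits.JohnsonLeungKings2011

variable {R : Type u} [CommRing R] (f : R) {A H0 H1 H2 : Type v} [AddCommGroup H0] [Module R H0] [AddCommGroup H1] [Module R H1]
  [AddCommGroup H2] [Module R H2] (D : ZetaSkeleton R A H0 H1 H2)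

/-- **The specialised zeta family** `a ↦ (image of _𝔞ζ in H¹₂ ⧸ fH¹₂)` — on the `θ`-line these are the images `z_θ` of the elliptic-unit classes.
[cite: JohnsonLeungKings2011, §5.2 (arXiv p0014:L100–105)] -/
def zetaSp (a : A) : QuotSMulTop f H1 :=
  Submodule.Quotient.mk (D.aZeta a)

/-- **The specialised zeta span** `ZSp ⊂ H¹₂ ⧸ fH¹₂`: the `R`-span of the specialised zeta family (= the image of `D.Z`, `ZSp_eq_map`).
[cite: JohnsonLeungKings2011, §5.2 (arXiv p0014:L100–105)] -/
def ZSp : Submodule R (QuotSMulTop f H1) :=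
  Submodule.span R (Set.range (zetaSp f D))

/-- `ZSp = (D.Z).map mk`. [cite: JohnsonLeungKings2011, §5.2] -/
theorem ZSp_eq_map : ZSp f D = (D.Z).map (f • (⊤ : Submodule R H1)).mkQ := by
  rw [ZSp, ZetaSkeleton.Z, Submodule.map_span, ← Set.range_comp]
  rfl

end Skeleton

end Summit.BirchSwinnertonDyer.BirchSwinnertonDyer.Theorems.SmallImageRttD2Spec

end
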